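import Mathlib
import Literature.Analysis.FluidPDE.KNSSLiouvilleGalileanFrame
import Summits.NavierStokesRegularity.OSWSelfSimilar.TypeIIInnerLimitDiscriminator
import Summits.NavierStokesRegularity.OSWSelfSimilar.TypeIIInnerLimitSwirlConcentration
import HarnessLib
/-!
# The Z1 inner-object MASTER THEOREM: every rider on ONE subsequence (zone Z1 TEMPLATE §T1.4-I (I-2)–(I-5), (G4)/(C9),
# (C7); kernel, unconditional)

HONEST FRAMING (cell ns-blowup GROUP B «PROFILE SEARCH», zone Z1; D-0035/D-0074): part XXXII of the Z1 dictionary. Parts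
XXVI (unit stream / (AX-L) counterexample), XXIX–XXX (vorticity convergence and the (α)/(β) discriminator) and XXXI (swirl
concentration) each CONSTRUCT THEIR OWN subsequence, so their riders cannot be combined by a reader. This file runs the
assembly once more and puts EVERY rider on ONE subsequence — the census sentence of zone Z1 as a single declaration:

`innerObject_master_of_singularity` — on K8's standing hypotheses verbatim (`IsMaximalSmoothSolution 1 0 u p T⋆`, `T⋆ > 0`,
`IsLerayHopfOn T⋆ 1 0 (u 0) u`, bounded on closed sub-slabs, axisymmetric slices, `|Γ(0, ·)| ≤ Mₛ`) there are gauge N-a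
zoom data `tₖ ∈ [T⋆/2, T⋆)`, `λₖ > 0 → 0`, `λₖ‖u‖ ≤ 1` on `[0, tₖ]`, centres `cₖ`, and ONE subsequence `φ` along which
* the zoom `y ↦ λₖu(tₖ + λₖ²s, cₖ + λₖy)` converges slice-wise locally uniformly to a KNSS blow-up limit `W` (smooth
  bounded ancient mild, `|W| ≤ 1 = sup`, WITH the Oseen identity),
* the zoomed vorticity `λₖ²ω(tₖ + λₖ²s, cₖ + λₖy)` converges pointwise to `curl W(s)(y)`,
and EXACTLY ONE of
* (α) `W ≡ c` with `‖c‖ = 1`, `c₁ = 0` (no azimuthal component; `±e_z` if the slices are axisymmetric), and the zoomed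
  vorticity tends to `0` EVERYWHERE (velocity-dominated, `μ_ωu → 0`);
* (β) the centres lie ON THE AXIS; `W` REFUTES `AxisymmetricLiouvilleBoundedSwirl` (axisymmetric slices, `|Γ_W| ≤ Mₛ`, a
  non-constant slice); `W` CARRIES VORTICITY (`curl W ≠ 0` somewhere — `μ_ωu ↛ 0`) and SWIRL, with the physical swirl
  CONCENTRATING at the velocity scale (`Γ(tₖ + λₖ²s, cₖ + λₖy) → Γ_W(s, y) ≠ 0` at some `(s, y)`); `r‖W_pol‖` and, for
  every real `c`, `r‖W_pol − c e_z‖` are unbounded (V-CR and its frame-optimised form, profile-lit g12's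
  `IsKNSSBlowupLimit.exists_lt_cylRadius_mul_norm_poloidal_sub_smul_eZ`); `Γ_W ∉ L^∞_sL^q` for `1 ≤ q < ∞`; `Γ_W` does
  not decay at radial infinity; and `Γ_W` does not approach any `L²` at the Lei–Ren–Zhang rate (absolute `ε₀`).
Every kill is a DISCHARGED tree theorem; no conjecture is assumed.

**Nothing here asserts that a singular solution exists or that (AX-L) holds or fails.** «violates: n/a — dictionary;
THE census sentence of Z1 by decl»; bears_on LADDER-NS N5/Z1 → N1 linear core / N0⁻. Author: ns-blowup-profile-eng-1 g8,
2026-08-27.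
-/

open Real Filter Topology Set MeasureTheory Function Bornology
open scoped ENNReal NNReal
open Literature.Analysis.FluidPDE

namespace Summit.NavierStokesRegularity.OSWSelfSimilar
namespace TypeIIModulationDictionary

section Master

variable {T Mₛ : ℝ} {u : ℝ → EuclideanSpace ℝ (Fin 3) → EuclideanSpace ℝ (Fin 3)}
  {p : ℝ → EuclideanSpace ℝ (Fin 3) → ℝ}

/-- Slice-wise locally uniform convergence passes to subsequences (bookkeeping). [new here — elementary] -/
theorem tendstoLocallyUniformly_subseq {X Y : Type*} [TopologicalSpace X] [UniformSpace Y] {F : ℕ → X → Y}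
    {f : X → Y} (h : TendstoLocallyUniformly F f atTop) {ψ : ℕ → ℕ} (hψ : StrictMono ψ) :
    TendstoLocallyUniformly (fun j => F (ψ j)) f atTop := by
  intro v hv x
  obtain ⟨t, ht, hev⟩ := h v hv x
  exact ⟨t, ht, hψ.tendsto_atTop.eventually hev⟩

/-- **THE Z1 INNER-OBJECT MASTER THEOREM (unconditional; every rider on ONE subsequence).** See the module docstring for
the reading; hypotheses = K8's standing hypotheses verbatim. [new here — dictionary; unconditional] -/
theorem innerObject_master_of_singularity (hT : 0 < T) (hmax : IsMaximalSmoothSolution 1 0 u p T)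
    (hLH : IsLerayHopfOn T 1 0 (u 0) u) (hbdd : ∀ S < T, ∃ N : ℝ, 0 < N ∧ ∀ t ∈ Icc 0 S, ∀ x, ‖u t x‖ ≤ N)
    (haxi : ∀ t, IsAxisymmetric (u t)) (hMₛ : ∀ x, |swirl (u 0) x| ≤ Mₛ) :
    ∃ (tn lamn : ℕ → ℝ) (cn : ℕ → EuclideanSpace ℝ (Fin 3)) (φ : ℕ → ℕ)
      (W : ℝ → EuclideanSpace ℝ (Fin 3) → EuclideanSpace ℝ (Fin 3)),
      (∀ k, T / 2 ≤ tn k ∧ tn k < T) ∧ (∀ k, 0 < lamn k) ∧ Tendsto lamn atTop (𝓝 0) ∧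
      (∀ k, ∀ t ∈ Icc 0 (tn k), ∀ x, lamn k * ‖u t x‖ ≤ 1) ∧ StrictMono φ ∧ IsKNSSBlowupLimit W ∧
      (∀ s < 0, TendstoLocallyUniformly
        (fun k => (lamn (φ k) • stPull (lamn (φ k) ^ 2) (lamn (φ k)) (tn (φ k)) (cn (φ k)) u) s) (W s) atTop) ∧
      (∀ s t : ℝ, s < t → t < 0 → ∀ x,
        W t x = Literature.Analysis.UnboundedOperators.heatExtension (W s) (t - s) x - oseenDuhamel 1 s W W t x) ∧
      (∀ s < 0, ∀ y : EuclideanSpace ℝ (Fin 3), Tendsto (fun j => lamn (φ j) ^ 2 •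
        curl (u (tn (φ j) + lamn (φ j) ^ 2 * s)) (cn (φ j) + lamn (φ j) • y)) atTop (𝓝 (curl (W s) y))) ∧
      (((∃ c : EuclideanSpace ℝ (Fin 3), ‖c‖ = 1 ∧ c 1 = 0 ∧ ∀ s < 0, ∀ y : EuclideanSpace ℝ (Fin 3), W s y = c) ∧
          ∀ s < 0, ∀ y : EuclideanSpace ℝ (Fin 3), Tendsto (fun j => lamn (φ j) ^ 2 •
            curl (u (tn (φ j) + lamn (φ j) ^ 2 * s)) (cn (φ j) + lamn (φ j) • y)) atTop (𝓝 0)) ∨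
        ((∀ k, cn k 0 = 0 ∧ cn k 1 = 0) ∧
          ¬ Summit.NavierStokesRegularity.NavierStokesRegularity.AxisymmetricLiouvilleBoundedSwirl ∧
          (∀ s < 0, IsAxisymmetric (W s)) ∧ (∀ s < 0, ∀ y : EuclideanSpace ℝ (Fin 3), |swirl (W s) y| ≤ Mₛ) ∧
          (∃ s < 0, ∃ x : EuclideanSpace ℝ (Fin 3), W s x ≠ W s 0) ∧
          (∃ s < 0, ∃ y : EuclideanSpace ℝ (Fin 3), curl (W s) y ≠ 0) ∧
          (∃ s < 0, ∃ y : EuclideanSpace ℝ (Fin 3), swirl (W s) y ≠ 0 ∧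
            Tendsto (fun k => swirl (u (tn (φ k) + lamn (φ k) ^ 2 * s)) (cn (φ k) + lamn (φ k) • y)) atTop
              (𝓝 (swirl (W s) y))) ∧
          (∀ C : ℝ, ∃ s < 0, ∃ x : EuclideanSpace ℝ (Fin 3), C < cylRadius x * ‖poloidalPart (W s) x‖) ∧
          (∀ c C : ℝ, ∃ s < 0, ∃ x : EuclideanSpace ℝ (Fin 3), C < cylRadius x * ‖poloidalPart (W s) x - c • eZ‖) ∧
          (∀ q : ℝ≥0∞, 1 ≤ q → q < ⊤ → ∀ K : ℝ≥0, ∃ s < 0, (K : ℝ≥0∞) < eLpNorm (swirl (W s)) q volume) ∧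
          (∃ ε : ℝ, 0 < ε ∧ ∀ R : ℝ, ∃ s < 0, ∃ x : EuclideanSpace ℝ (Fin 3),
            R ≤ cylRadius x ∧ ε < |swirl (W s) x|) ∧
          ∃ ε₀ ∈ Set.Ioo (0 : ℝ) 1, ∀ L R₀ : ℝ, ∃ s < 0, ∃ x : EuclideanSpace ℝ (Fin 3),
            R₀ ≤ cylRadius x ∧ ε₀ * L ^ 2 / cylRadius x < |swirl (W s) x ^ 2 - L ^ 2|)) := by
  have hT2 : 0 < T / 2 := by positivity
  have hE := energyBound_of_lerayHopf hLH
  have hunb := unbounded_of_not_hasSmoothExtensionPast hT hmax.1 hLH hmax.2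
  have hu := hmax.1
  obtain ⟨tn, lamn, rn, zn, htn, hlam, hlam0, hrn, hgauge, hnear⟩ :=
    exists_meridional_zoom_data_of_unbounded hT haxi hbdd hunb
  by_cases hbA : BddAbove (Set.range fun k => rn k / lamn k)
  · -- ### Case A along a subsequence: axis-centred zoom
    obtain ⟨C, hC⟩ := hbA
    obtain ⟨d, -, ψ, hψ, hd⟩ := tendsto_subseq_of_bounded (Metric.isBounded_Icc (0 : ℝ) C)
      (x := fun k => rn k / lamn k) fun k => ⟨div_nonneg (hrn k) (hlam k).le, hC ⟨k, rfl⟩⟩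
    obtain ⟨φ₁, W, hφ₁, hW, hconv₁, hax, hsw⟩ :=
      innerLimit_caseA_data_standing hT hu haxi hE hbdd hMₛ
        (tn := tn ∘ ψ) (lamn := lamn ∘ ψ) (rn := rn ∘ ψ) (zn := zn ∘ ψ) hT2 (fun k => htn (ψ k))
        (fun k => hlam (ψ k)) (hlam0.comp hψ.tendsto_atTop) (fun k => hgauge (ψ k))
        (hnear.comp hψ.tendsto_atTop) hd
    -- refine so that the vorticities converge too
    obtain ⟨ψ₂, hψ₂, hcurl⟩ := zoom_limit_curl_tendsto hu hE hbdd (tn := tn ∘ ψ) (lamn := lamn ∘ ψ)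
      (xn := fun k => EuclideanSpace.single 2 (zn (ψ k))) hT2 (fun k => htn (ψ k)) (fun k => hlam (ψ k))
      (hlam0.comp hψ.tendsto_atTop) (fun k => hgauge (ψ k)) hφ₁ hconv₁
    set φ : ℕ → ℕ := φ₁ ∘ ψ₂ with hφdef
    have hφ : StrictMono φ := hφ₁.comp hψ₂
    have hconv : ∀ s < 0, TendstoLocallyUniformly (fun k => ((lamn ∘ ψ) (φ k) •
        stPull ((lamn ∘ ψ) (φ k) ^ 2) ((lamn ∘ ψ) (φ k)) ((tn ∘ ψ) (φ k)) (EuclideanSpace.single 2 (zn (ψ (φ k)))) u) s)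
        (W s) atTop := fun s hs => tendstoLocallyUniformly_subseq (hconv₁ s hs) hψ₂
    have hmild := zoom_limit_oseenIdentity hu hE hbdd (tn := tn ∘ ψ) (lamn := lamn ∘ ψ)
      (xn := fun k => EuclideanSpace.single 2 (zn (ψ k))) hT2 (fun k => htn (ψ k)) (fun k => hlam (ψ k))
      (hlam0.comp hψ.tendsto_atTop) (fun k => hgauge (ψ k)) hφ hW.smooth.continuousOn hconv
    have hcax : ∀ k, (EuclideanSpace.single 2 (zn (ψ k)) : EuclideanSpace ℝ (Fin 3)) 0 = 0 ∧
        (EuclideanSpace.single 2 (zn (ψ k)) : EuclideanSpace ℝ (Fin 3)) 1 = 0 := fun k => by simp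
    refine ⟨tn ∘ ψ, lamn ∘ ψ, fun k => EuclideanSpace.single 2 (zn (ψ k)), φ, W, fun k => htn (ψ k),
      fun k => hlam (ψ k), hlam0.comp hψ.tendsto_atTop, fun k => hgauge (ψ k), hφ, hW, hconv, hmild, hcurl, ?_⟩
    by_cases hnc : ∃ s < 0, ∃ x : EuclideanSpace ℝ (Fin 3), W s x ≠ W s 0
    · -- (β) with every rider
      have hsw' : ∃ C : ℝ, ∀ s < 0, ∀ x, |swirl (W s) x| ≤ C := ⟨Mₛ, hsw⟩
      have hnc' : ∃ s < 0, ∃ x y : EuclideanSpace ℝ (Fin 3), W s x ≠ W s y := by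
        obtain ⟨s, hs, x, hx⟩ := hnc
        exact ⟨s, hs, x, 0, hx⟩
      obtain ⟨s, hs, y, hy⟩ := typeBeta_exists_swirl_ne_zero hW hax hnc
      obtain ⟨ε₀, hε₀, hrate⟩ := typeBeta_not_swirl_rate
      exact Or.inr ⟨hcax, not_axisymmetricLiouville_of_innerLimit_typeBeta hW hax hsw' hnc, hax, hsw, hnc,
        (knssBlowupLimit_typeBeta_iff_exists_curl_ne_zero hW).1 hnc,
        ⟨s, hs, y, hy, swirl_innerLimit_tendsto hcax hconv s hs y⟩, knssBlowupLimit_VCR_poloidal hW hax hsw',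
        fun c C => hW.exists_lt_cylRadius_mul_norm_poloidal_sub_smul_eZ hax hsw' hnc' c C,
        fun q hq1 hq K => typeBeta_eLpNorm_swirl_unbounded hW hax hnc hq1 hq K,
        typeBeta_swirl_not_decay hW hax hnc, ε₀, hε₀, hrate W hW hax hsw' hnc⟩
    · -- (α): axial unit stream, vorticity → 0
      push Not at hnc
      obtain ⟨β, hβ, hWβ⟩ := innerLimit_axialUnitStream_of_const hW hmild hax hnc
      refine Or.inl ⟨⟨β • eZ, ?_, by simp [eZ], hWβ⟩, fun s hs y => ?_⟩
      · rw [norm_smul, Real.norm_eq_abs, hβ]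
        simp [eZ]
      · have hcs : W s = fun _ => β • eZ := funext (hWβ s hs)
        have h0 : curl (W s) y = 0 := by rw [hcs, curl_eq_curlCLM, fderiv_const_apply, map_zero]
        simpa [h0, hφdef, Function.comp_apply] using hcurl s hs y
  · -- ### Case B along a subsequence: (α)
    obtain ⟨ψ, hψ, hd⟩ := exists_subseq_tendsto_atTop_of_not_bddAbove hbA
    obtain ⟨φ₁, W, hφ₁, hW, hconv₁, hconst⟩ :=
      innerLimit_const_caseB_standing hu haxi hE hbdd (tn := tn ∘ ψ) (lamn := lamn ∘ ψ) (rn := rn ∘ ψ)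
        (zn := zn ∘ ψ) hT2 (fun k => htn (ψ k)) (fun k => hlam (ψ k)) (hlam0.comp hψ.tendsto_atTop)
        (fun k => hgauge (ψ k)) (hnear.comp hψ.tendsto_atTop) hd
    obtain ⟨ψ₂, hψ₂, hcurl⟩ := zoom_limit_curl_tendsto hu hE hbdd (tn := tn ∘ ψ) (lamn := lamn ∘ ψ)
      (xn := fun k => EuclideanSpace.single 0 (rn (ψ k)) + EuclideanSpace.single 2 (zn (ψ k))) hT2
      (fun k => htn (ψ k)) (fun k => hlam (ψ k)) (hlam0.comp hψ.tendsto_atTop) (fun k => hgauge (ψ k)) hφ₁ hconv₁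
    set φ : ℕ → ℕ := φ₁ ∘ ψ₂ with hφdef
    have hφ : StrictMono φ := hφ₁.comp hψ₂
    have hconv : ∀ s < 0, TendstoLocallyUniformly (fun k => ((lamn ∘ ψ) (φ k) •
        stPull ((lamn ∘ ψ) (φ k) ^ 2) ((lamn ∘ ψ) (φ k)) ((tn ∘ ψ) (φ k))
          (EuclideanSpace.single 0 (rn (ψ (φ k))) + EuclideanSpace.single 2 (zn (ψ (φ k)))) u) s) (W s) atTop :=
      fun s hs => tendstoLocallyUniformly_subseq (hconv₁ s hs) hψ₂
    have hmild := zoom_limit_oseenIdentity hu hE hbdd (tn := tn ∘ ψ) (lamn := lamn ∘ ψ)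
      (xn := fun k => EuclideanSpace.single 0 (rn (ψ k)) + EuclideanSpace.single 2 (zn (ψ k))) hT2
      (fun k => htn (ψ k)) (fun k => hlam (ψ k)) (hlam0.comp hψ.tendsto_atTop) (fun k => hgauge (ψ k)) hφ
      hW.smooth.continuousOn hconv
    have h1 := caseB_limit_apply_one_eq_zero hT hu haxi hbdd hMₛ (tn := tn ∘ ψ) (lamn := lamn ∘ ψ)
      (rn := rn ∘ ψ) (zn := zn ∘ ψ) hT2 (fun k => htn (ψ k)) (fun k => hlam (ψ k))
      (hlam0.comp hψ.tendsto_atTop) (hnear.comp hψ.tendsto_atTop) hd hφ hconv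
    obtain ⟨c, hc1, hc⟩ := innerLimit_unitStream_of_const hW hmild hconst
    refine ⟨tn ∘ ψ, lamn ∘ ψ, fun k => EuclideanSpace.single 0 (rn (ψ k)) + EuclideanSpace.single 2 (zn (ψ k)), φ, W,
      fun k => htn (ψ k), fun k => hlam (ψ k), hlam0.comp hψ.tendsto_atTop, fun k => hgauge (ψ k), hφ, hW, hconv,
      hmild, hcurl, Or.inl ⟨⟨c, hc1, ?_, hc⟩, fun s hs y => ?_⟩⟩
    · rw [← hc (-1) (by norm_num) 0]
      exact h1 (-1) (by norm_num)
    · have hcs : W s = fun _ => c := funext (hc s hs)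
      have h0 : curl (W s) y = 0 := by rw [hcs, curl_eq_curlCLM, fderiv_const_apply, map_zero]
      simpa [h0, hφdef, Function.comp_apply] using hcurl s hs y

end Master

end TypeIIModulationDictionary
end Summit.NavierStokesRegularity.OSWSelfSimilar
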